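import Literature.AlgebraicGeometry.FormalGeometry.TowerModule
import Literature.AlgebraicGeometry.Deformation.GrothendieckExistenceVectorBundles
import HarnessLib

/-!
# Grothendieck's existence theorem for vector bundles on a proper `W(k)`-scheme, in the language
# of modules over the formal completion (GW Def. 24.85 / Rem. 24.86)

The named fact `GortzWedhorn2023_thm2494_vectorBundle_witt`
(`Deformation/GrothendieckExistenceVectorBundles.lean`; Görtz–Wedhorn II Thm. 24.94 with
Prop. 24.95 for finite locally free modules on a proper `W(k)`-scheme) was transcribed with its
formal datum spelled out ad hoc: a family `E n` of modules on the thickenings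
`X_{n+1} = 𝒳 ⊗_W W/p^{n+1}` with merely EXISTING isomorphisms `E (n+1)|_{X_{n+1}} ≅ E n`. This
file restates that datum in the vocabulary of GW Def. 24.85 / Rem. 24.86, now in the tree as
`Literature.AlgebraicGeometry.FormalGeometry.TowerModule` (`FormalGeometry/TowerModule.lean`):

* `FormalModule 𝒳` — the category `(X_{/X_k}-Mod)` of modules over the formal completion of a
  `W(k)`-scheme `𝒳` along its special fibre, i.e. modules over the `p`-adic thickening tower
  `(X_{n+1}, X_{n+1} → X_{n+2})_n` of `Literature.AlgebraicGeometry.Motives.WittScheme`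
  (`thickening`, `thickeningMap`); `formalCompletion 𝒳 : 𝒳.left.Modules ⥤ FormalModule 𝒳` — the
  functor `ℱ ↦ ℱ_{/X_k} = (ℱ|_{X_{n+1}})_n` of (24.18.1), the tower sitting under `𝒳` through the
  closed immersions `thickeningι 𝒳 (n+1)` (`thickeningMap_ι`). Both are `abbrev`s of the general
  notions.
* `formalCompletion_isVectorBundle` — the completion of a vector bundle is a locally free module of
  finite type over `X_{/X_k}` (Def. 24.85 (2); the easy direction of Prop. 24.95).
* `liftsFormally_iff_exists_formalModule` — the tree's `WittScheme.LiftsFormally 𝒳 E₁` says exactly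
  that `E₁` is the special-fibre restriction of the level-`0` term of a locally free module of
  finite type over `X_{/X_k}`.
* `thm2494_vectorBundle_witt_iff_formalModule` — **the fact is equivalent to:** for every proper
  `𝒳/W(k)` (`k` perfect of characteristic `p`), every locally free module of finite type `ℰ` over
  `X_{/X_k}` is, level by level, isomorphic to the completion of a vector bundle `ℱ` on `𝒳`
  (`(ℱ_{/X_k})_n ≅ ℰ_n` for all `n`). The passage from the fact's `Nonempty`-isomorphism hypotheses
  to an object of `(X_{/X_k}-Mod)` is `TowerModule.ofNonemptyIso` (no cocycle condition for an
  `ℕ`-indexed tower). As recorded in the fact's file, this is WEAKER than essential surjectivity of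
  `formalCompletion 𝒳` on such objects (the level isomorphisms are not asserted to form a morphism
  of `(X_{/X_k}-Mod)`), which in turn is weaker than the printed equivalence of categories
  (Thm. 24.94 + Prop. 24.95); `thm2494_vectorBundle_witt_of_essSurj` records the first implication.

No named fact is introduced; the two `abbrev`s are the only definitions.

## References

* U. Görtz, T. Wedhorn, *Algebraic Geometry II: Cohomology of Schemes*, Springer Spektrum 2023,
  Def. 24.85, Rem./Def. 24.86, (24.18.1) (pp. 561–562); Thm. 24.94, Prop. 24.95 (p. 566).
  [GortzWedhorn2023]
-/

noncomputable section

open CategoryTheory AlgebraicGeometry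

namespace Literature.AlgebraicGeometry.Deformation

open Literature.AlgebraicGeometry.Motives Literature.AlgebraicGeometry.Motives.WittScheme
open Literature.AlgebraicGeometry.FormalGeometry

universe u

section Vocabulary

variable {p : ℕ} [Fact p.Prime] {k : Type u} [CommRing k]

/-- **Modules over the formal completion `X_{/X_k}` of a `W(k)`-scheme along its special fibre**
(GW Rem./Def. 24.86 with Def. 24.85 (1), for `X = 𝒳`, `𝒥 = p𝒪_𝒳`, `X_n = 𝒳 ⊗_W W/p^{n+1}`): modules
over the `p`-adic thickening tower `(X_{n+1})_n` with its transition closed immersions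
`X_{n+1} → X_{n+2}` (`WittScheme.thickening`, `WittScheme.thickeningMap`). An `abbrev` of
`FormalGeometry.TowerModule`. [cite: GortzWedhorn2023, Rem./Def. 24.86 (p. 562)] -/
abbrev FormalModule (𝒳 : SchemeOver (WittVector p k)) : Type (u + 1) :=
  TowerModule (fun n => (thickening 𝒳 (n + 1)).left) fun n => thickeningMap 𝒳 (Nat.le_succ (n + 1))

/-- **The formal completion functor `ℱ ↦ ℱ_{/X_k} = (ℱ|_{X_{n+1}})_n`** of a `W(k)`-scheme along
its special fibre (GW (24.18.1)): inverse images along the closed immersions `X_{n+1} → 𝒳`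
(`WittScheme.thickeningι`), with the canonical structure isomorphisms coming from
`X_{n+1} → X_{n+2} → 𝒳 = X_{n+1} → 𝒳` (`WittScheme.thickeningMap_ι`). An `abbrev` of
`FormalGeometry.TowerModule.completion`. [cite: GortzWedhorn2023, (24.18.1) (p. 562)] -/
abbrev formalCompletion (𝒳 : SchemeOver (WittVector p k)) : 𝒳.left.Modules ⥤ FormalModule 𝒳 :=
  TowerModule.completion (fun n => thickeningι 𝒳 (n + 1)) fun n =>
    thickeningMap_ι 𝒳 (Nat.le_succ (n + 1))

/-- The levels of the formal completion are the restrictions to the thickenings: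
`(ℱ_{/X_k})_n = ℱ|_{X_{n+1}} = (thickeningι 𝒳 (n+1))^* ℱ` (by `rfl`). [folklore] -/
theorem formalCompletion_obj_obj (𝒳 : SchemeOver (WittVector p k)) (F : 𝒳.left.Modules) (n : ℕ) :
    ((formalCompletion 𝒳).obj F).obj n = (Scheme.Modules.pullback (thickeningι 𝒳 (n + 1))).obj F :=
  rfl

/-- **The completion of a vector bundle is a locally free module of finite type over `X_{/X_k}`**
(GW Def. 24.85 (2); "If `ℱ` is locally free of rank `r`, then `ℱ_{/Z} = (i_n^* ℱ)_n` is clearly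
locally free", proof of Prop. 24.95, p. 567). [cite: GortzWedhorn2023, Prop. 24.95, proof (p. 567)] -/
theorem formalCompletion_isVectorBundle (𝒳 : SchemeOver (WittVector p k)) {F : 𝒳.left.Modules}
    (hF : IsVectorBundle F) : ((formalCompletion 𝒳).obj F).IsVectorBundle :=
  TowerModule.completion_isVectorBundle _ _ hF

/-- **`WittScheme.LiftsFormally` in the language of Def. 24.85.** A module `E₁` on the special
fibre lifts formally (`Motives/CrystallineRealization.lean`: a compatible system of vector bundles
on the thickenings restricting to `E₁`) iff it is the restriction along `X_k → X_1` of the level-`0`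
term of a locally free module of finite type over `X_{/X_k}` (`→`: `TowerModule.ofNonemptyIso`;
`←`: forget the structure isomorphisms to their existence).
[cite: GortzWedhorn2023, Def. 24.85 (p. 561)] -/
theorem liftsFormally_iff_exists_formalModule [CharP k p] (𝒳 : SchemeOver (WittVector p k))
    (E₁ : (specialFibre 𝒳).left.Modules) :
    LiftsFormally 𝒳 E₁ ↔ ∃ E : FormalModule 𝒳, E.IsVectorBundle ∧
      Nonempty ((Scheme.Modules.pullback (specialFibreToThickening 𝒳 0)).obj (E.obj 0) ≅ E₁) := by
  constructor
  · rintro ⟨E, hE, hα, h0⟩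
    exact ⟨TowerModule.ofNonemptyIso E hα, hE, h0⟩
  · rintro ⟨E, hE, h0⟩
    exact ⟨E.obj, hE, fun n => ⟨E.iso n⟩, h0⟩

end Vocabulary

/-! ### The fact in the language of modules over `X_{/X_k}` -/

/-- **`GortzWedhorn2023_thm2494_vectorBundle_witt` ⇔ level-wise algebraization of locally free
modules of finite type over `X_{/X_k}`.** The fact holds iff for every prime `p`, perfect field `k`
of characteristic `p` and proper `𝒳 → Spec W(k)`, every locally free module of finite type `ℰ` over
the formal completion `X_{/X_k}` (GW Def. 24.85) admits a vector bundle `ℱ` on `𝒳` with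
`(ℱ_{/X_k})_n ≅ ℰ_n` for every `n`. (`→`: apply the fact to the levels of `ℰ` and its structure
isomorphisms; `←`: a family with `Nonempty` structure isomorphisms is a module over the tower,
`TowerModule.ofNonemptyIso` — no cocycle condition arises for an `ℕ`-indexed tower.)
[cite: GortzWedhorn2023, Def. 24.85 (p. 561), Thm. 24.94 and Prop. 24.95 (p. 566)] -/
theorem thm2494_vectorBundle_witt_iff_formalModule :
    GortzWedhorn2023_thm2494_vectorBundle_witt ↔
      ∀ (p : ℕ) [Fact p.Prime] (k : Type) [Field k] [CharP k p] [PerfectRing k p]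
        (𝒳 : SchemeOver (WittVector p k)), IsProper 𝒳.hom →
        ∀ E : FormalModule 𝒳, E.IsVectorBundle →
          ∃ F : 𝒳.left.Modules, IsVectorBundle F ∧
            ∀ n : ℕ, Nonempty (((formalCompletion 𝒳).obj F).obj n ≅ E.obj n) := by
  constructor
  · intro h p _ k _ _ _ 𝒳 h𝒳 E hE
    exact h p k 𝒳 h𝒳 E.obj hE fun n => ⟨E.iso n⟩
  · intro h p _ k _ _ _ 𝒳 h𝒳 E hE hα
    exact h p k 𝒳 h𝒳 (TowerModule.ofNonemptyIso E hα) hE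

/-- **Essential surjectivity of `ℱ ↦ ℱ_{/X_k}` on locally free modules of finite type implies the
fact** (the fact asserts only level-wise isomorphisms `(ℱ_{/X_k})_n ≅ ℰ_n`, an isomorphism
`ℱ_{/X_k} ≅ ℰ` in `(X_{/X_k}-Mod)` being such a family compatible with the structure isomorphisms;
GW Thm. 24.94 + Prop. 24.95 give the stronger statement). [cite: GortzWedhorn2023, Thm. 24.94 and Prop. 24.95 (p. 566)] -/
theorem thm2494_vectorBundle_witt_of_essSurj
    (h : ∀ (p : ℕ) [Fact p.Prime] (k : Type) [Field k] [CharP k p] [PerfectRing k p]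
      (𝒳 : SchemeOver (WittVector p k)), IsProper 𝒳.hom →
      ∀ E : FormalModule 𝒳, E.IsVectorBundle →
        ∃ F : 𝒳.left.Modules, IsVectorBundle F ∧ Nonempty ((formalCompletion 𝒳).obj F ≅ E)) :
    GortzWedhorn2023_thm2494_vectorBundle_witt := by
  refine thm2494_vectorBundle_witt_iff_formalModule.2 fun p _ k _ _ _ 𝒳 h𝒳 E hE => ?_
  obtain ⟨F, hF, ⟨e⟩⟩ := h p k 𝒳 h𝒳 E hE
  exact ⟨F, hF, fun n => ⟨TowerModule.evalMapIso e n⟩⟩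

end Literature.AlgebraicGeometry.Deformation

end
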